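/-
Copyright: the b2b-balaban cell (near-miss cell 7), T⁴-continuum fan-out, lineage t4-ne7b-p1 (node U5c COUNT member).
Released under the licence of the surrounding project.
-/
import Summits.QuantumFields.BalabanUV.T4Continuum.Support.PartnerMultiplicityG
import Summits.QuantumFields.BalabanUV.T4Continuum.Support.CrowdingWeighted

/-!
# The count member's chain with the ZONE-CROWDING binder (`hlabZ`): crowding theorem wired into the chain

Summits-side support leaf of the T⁴-continuum cell (rung (B)+1 on a FINITE torus only; NOT infinite volume, NOT the
mass gap, NOT the Clay statement; NOT a proof of the spine estimate NE7b).  Lineage `t4-ne7b-p1`, node U5c, wall (GM),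
located item G-ne7bp1g18-2 parts (I)∕(II) — the binder owner's half, third re-typing.  [folklore] bookkeeping over
the lineage's OWN typed carrier; nothing is quoted from print and nothing printed is asserted.

WHAT.  The zone form of the placement assembly (one term per merger) produces, per live slot, a multiplicity
`K₀^{#mergers} · ∏_{mergers Z} q_Z^p · Λ′^{partnerAges}` with the zone drivers `q_Z ≤ Q(wcnt G, σ, t_Z)` (discounted
fatness-weighted crowding, chronology of sub-events).  This file states the count member's chain with the binder

  `hlabZ`:  `y ≤ 0 ∨ ∃ G, Consistent ∧ WF ∧ rootStep = j ∧ K < reach ∧ root = b ∧ events ∖ root = Q ∧`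
            `y ≤ K₀^{#merges G} · (∏_{e ∈ merges G} Q(wcnt G, σ, step e)^p) · Λ′^{partnerAges G}`
            `      · e^{−credits (credit C g_K) G} · e^{+lifeCost G}`

and proves it (`exists_irThreshold_relWeightBoundZ`) from `Support/PartnerMultiplicityG` (class-linear binder) and
the weighted crowding theorem (`Support/CrowdingWeighted.prod_rpow_Qw_le`): pointwise (`zone_surcharge_le`)

  `K₀^{#merges} · ∏ Q^p · Λ′^{partnerAges}`
      `≤ exp((log K₀ + θ + 2·crowdA p σ (min(ε,θ)∕8))·Σ_{births}(d′+1)) · (Λ′e^{ε})^{partnerAges}`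

for every `ε, θ > 0` (`#merges ≤ Σ(d′+1)` by `card_merges_add_one`).  DISPLAYED BINDERS that differ from the landed
`exists_irThreshold_relWeightBoundM`: `1 ≤ C.A₀`; the zone constants `1 ≤ K₀`, `0 ≤ p`, `0 < σ < 1`; free rates
`0 < ε`, `0 < θ` with the ROOM CONDITION `log K₀ + θ + 2·crowdA p σ (min(ε,θ)∕8) < C.a` (was `0 < C.a`); and the
placement-rate condition `Λ′·e^{ε}·e^{−κ₁} ≤ 1` (was `Λ′·e^{−κ₁} ≤ 1`) — the ε-sliver of the count chain's rate that
the crowding theorem consumes.  SAME threshold shape, SAME budgets, SAME rate `Λ·e^{η̄ − κ₁} < 1`, SAME conclusion.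

WHAT THIS FILE DOES NOT DO.  It does not inhabit `hlabZ`: that is the abstract ZONE SKELETON (admissible placements in
zone form `≤ Λ^{partnerAges}·∏_Z M₀(C₀+1)^d q_Z^d` under the displayed contraction law of extents and the zone-touch
count) instantiated behind the reading (ID) (G-ne7bp1g9-1), with `q_Z ≤ Q(wcnt G)` from the chronology of sub-events;
nor the per-record price (E2)∕(R1) (G-ne7bp1-1); nor whether print's `a` has the room (an (E2)-side constant; the
constant `crowdA` is astronomically large as typed — `8!·e·max(1,1∕ℓ)⁸·p³∕η²` — and no optimisation is attempted).
NE7b discharge: no date.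

HONEST DEPENDENCY (cell): continuum YM on T⁴ ⇐ BetaPertH ∧ nine spine estimates (0/9 proved); BetaPertH ⇐ (D1) ∧ (D4)
∧ CAP+tail.  This file changes none of it.
-/

open Finset
open Literature.MathematicalPhysics.QuantumFieldTheory.Balaban1983to89
open T4PersistenceDictionary T4PersistentHistoryCount T4BankedInduction T4PrintedShapeBanking
open T4WeightBudget T4GlobalDenominator T4LiveClassFibration T4LiveStructureGas T4LiveGasToTerms T4RecordPriceSeam
open T4PartnerMultiplicity
open Summit.QuantumFields.BalabanUV.T4Continuum.PlacementBatch
open Summit.QuantumFields.BalabanUV.T4Continuum.PlacementSkeleton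
open Summit.QuantumFields.BalabanUV.T4Continuum.PartnerMultiplicityF
open Summit.QuantumFields.BalabanUV.T4Continuum.PartnerMultiplicityG
open Summit.QuantumFields.BalabanUV.T4Continuum.Crowding

namespace Summit.QuantumFields.BalabanUV.T4Continuum.PartnerMultiplicityZ

noncomputable section

/-! ## §1 The zone surcharge is class-linear (pointwise, K-free) -/

/-- THE ROOM the zone form asks of the quadratic birth constant: `zoneRate K₀ p σ ε θ = log K₀ + θ + 2·crowdA`.
[folklore] -/
def zoneRate (K₀ p σ ε θ : ℝ) : ℝ := Real.log K₀ + θ + 2 * crowdA p σ (min ε θ / 8)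

/-- `zoneRate ≥ 0` for `K₀ ≥ 1`, `p ≥ 0`, `σ ∈ (0,1)`, `θ ≥ 0` [folklore] -/
theorem zoneRate_nonneg {K₀ p σ ε θ : ℝ} (hK : 1 ≤ K₀) (hp : 0 ≤ p) (h0 : 0 < σ) (h1 : σ < 1) (hθ : 0 ≤ θ) :
    0 ≤ zoneRate K₀ p σ ε θ := by
  have h1' := Real.log_nonneg hK
  have h2' := crowdA_nonneg hp h0 h1 (min ε θ / 8)
  unfold zoneRate
  positivity

variable (W : PEv → ℕ)

/-- **THE ZONE SURCHARGE IS CLASS-LINEAR.**  For a consistent well-formed genealogy and `K₀ ≥ 1`, `p ≥ 0`,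
`σ ∈ (0,1)`, `ε, θ > 0`, `Λ′ ≥ 0`:
`K₀^{#merges} · ∏_{mergers} Q(wcnt G, σ, step)^p · Λ′^{partnerAges}`
`  ≤ exp(zoneRate·Σ_{births}(d′+1)) · (Λ′e^{ε})^{partnerAges}`. [folklore] -/
theorem zone_surcharge_le {C : T4PrintedShapeBanking.Consts} {K : ℕ} {R : ℕ → ℕ} {K₀ p σ ε θ Λ' : ℝ}
    (hK : 1 ≤ K₀) (hp : 0 ≤ p) (h0 : 0 < σ) (h1 : σ < 1) (hε : 0 < ε) (hθ : 0 < θ) (hΛ : 0 ≤ Λ')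
    {G : Gen PEv} (hc : Consistent C K R G) (hW : G.WF W) :
    K₀ ^ (merges G).card * (∏ e ∈ merges G, Q (wcnt G) σ e.step ^ p) * Λ' ^ partnerAges PEv.step G ≤
      Real.exp (zoneRate K₀ p σ ε θ * ∑ b ∈ births G, ((b.fat : ℝ) + 1)) *
        (Λ' * Real.exp ε) ^ partnerAges PEv.step G := by
  set F := ∑ b ∈ births G, ((b.fat : ℝ) + 1) with hF
  have hF0 : 0 ≤ F := sum_nonneg fun _ _ => by positivity
  have hcrowd := prod_rpow_Qw_le W hp h0 h1 hε hθ hW (stepsOK_of_consistent hc) (ordered_of_consistent hc)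
    (kind_eq_zero_of_mem_births hc)
  have hm : ((merges G).card : ℝ) ≤ F := card_merges_le_fatSum W hW
  have hlog : 0 ≤ Real.log K₀ := Real.log_nonneg hK
  have hK0 : 0 < K₀ := lt_of_lt_of_le zero_lt_one hK
  have hKm : K₀ ^ (merges G).card ≤ Real.exp (Real.log K₀ * F) := by
    rw [← Real.rpow_natCast, Real.rpow_def_of_pos hK0]
    exact Real.exp_le_exp.2 (by nlinarith)
  have hP : 0 ≤ ∏ e ∈ merges G, Q (wcnt G) σ e.step ^ p :=
    prod_nonneg fun e he => (Real.rpow_pos_of_pos (lt_of_lt_of_le zero_lt_one (one_le_Qw_of_mem h0.le he)) p).le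
  have hΛp : 0 ≤ Λ' ^ partnerAges PEv.step G := pow_nonneg hΛ _
  calc K₀ ^ (merges G).card * (∏ e ∈ merges G, Q (wcnt G) σ e.step ^ p) * Λ' ^ partnerAges PEv.step G
      ≤ Real.exp (Real.log K₀ * F) * (Real.exp ((θ + 2 * crowdA p σ (min ε θ / 8)) * F) *
          Real.exp ε ^ partnerAges PEv.step G) * Λ' ^ partnerAges PEv.step G :=
        mul_le_mul_of_nonneg_right (mul_le_mul hKm hcrowd hP (Real.exp_pos _).le) hΛp
    _ = Real.exp (zoneRate K₀ p σ ε θ * F) * (Λ' * Real.exp ε) ^ partnerAges PEv.step G := by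
        rw [zoneRate]; simp only [add_mul, Real.exp_add, mul_pow]; ring

/-! ## §2 End to end with the zone-crowding binder -/

section EndToEnd

variable {γ κ ι : Type*} [DecidableEq γ] [DecidableEq κ] {l₀ : ℝ} {K₀ : ℕ} {π : ℕ → ι → κ} {T : ℕ → Finset ι}
  {A A' : ℕ → ℝ → ι → ℝ} {Bad' : ℕ → ℝ → Finset κ} {dead dead' : ℕ → ℝ → ι → ℝ} {F Rf F' Rf' : ℕ → κ → ℝ}
  {nlow nup mlow mup : ℕ → ℝ → ℝ} {Cn : ℝ}

/-- **END TO END WITH THE ZONE-CROWDING MULTIPLICITY — ONE INFRARED THRESHOLD, THEN THE WEIGHT SLOT.**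
`T4PartnerMultiplicity.exists_irThreshold_relWeightBoundM` VERBATIM except: (i) the labelling binder is `hlabZ` — the
price of a live slot `(j, z, b, Q)` of cutoff `K` is `≤ 0` or at most
`Kz^{#merges G} · (∏_{e ∈ merges G} Q(wcnt G, σ, step e)^p) · Λ′^{partnerAges G} · e^{−credits (credit C g_K) G}`
`  · e^{+lifeCost G}` for SOME consistent well-formed genealogy `G` born at `j`, pending at `K`, with root `b` and
record `Q`; (ii) `1 ≤ C.A₀`; (iii) zone constants `1 ≤ Kz`, `0 ≤ p`, `0 < σ < 1`, free rates `0 < ε`, `0 < θ` with the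
room condition `zoneRate Kz p σ ε θ < C.a` (was `0 < C.a`); (iv) the placement-rate condition `Λ′·e^{ε}·e^{−κ₁} ≤ 1`
(was `Λ′·e^{−κ₁} ≤ 1`).  SAME threshold shape, budgets, rate `Λ·e^{η̄ − κ₁} < 1`, conclusion.  Proof:
`PartnerMultiplicityG.exists_irThreshold_relWeightBoundG` at `θ := zoneRate`, `Λ′ := Λ′e^{ε}`; `hlabZ ⇒ hlabG` by
`zone_surcharge_le`. [folklore] -/
theorem exists_irThreshold_relWeightBoundZ (C : T4PrintedShapeBanking.Consts) (hC : C.Valid) {Kz p σ ε θ : ℝ}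
    (hKz : 1 ≤ Kz) (hp : 0 ≤ p) (h0 : 0 < σ) (h1 : σ < 1) (hε : 0 < ε) (hθ : 0 < θ)
    (ha : zoneRate Kz p σ ε θ < C.a) (hA₀ : 1 ≤ C.A₀) {L r : ℕ} (hL : 1 ≤ L) {β₀ : ℝ} (hβ : 0 ≤ β₀)
    (hrq : r * (C.q' + 1) < C.p₀)
    (Cell : ℕ → ℕ → Finset γ) {V Λ : ℝ} (hV : 0 ≤ V) (hΛ : 0 < Λ)
    (hcell : ∀ K a, ((Cell K a).card : ℝ) ≤ V * Λ ^ a) (E B : ℕ → ℕ → Finset PEv)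
    (hE : ∀ K j, ∀ e ∈ E K j, PEv.step e ∈ Ioc j K) (jstar : ℕ → ℕ) (hj : ∀ K, jstar K ≤ K) {c : ℝ} (hc : 0 < c)
    (hfrac : ∀ K : ℕ, c * K ≤ ((K - jstar K : ℕ) : ℝ))
    (hA : Regeneration l₀ π T A Bad' dead F Rf nlow nup Cn K₀)
    (hA' : Regeneration l₀ π T A' Bad' dead' F' Rf' mlow mup Cn K₀) (hCn : 0 ≤ Cn) :
    ∃ x₀ : ℝ, ∀ (R : ℕ → ℕ → ℕ) (g : ℕ → ℕ → ℝ) (β' : ℕ → ℝ),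
      (∀ K, K₀ ≤ K → B14.FlowIneq27 (g K) (β' K) β₀ C.p₀ K) →
      (∀ K, K₀ ≤ K → B14FlowStep.FlowIneq29 (R K) (g K) L (β' K) β₀ K) →
      (∀ K, K₀ ≤ K → ∀ s, s ≤ K → B14.IsRj L r (g K s) (R K s)) →
      (∀ K, K₀ ≤ K → ∀ s, s ≤ K → 1 ≤ Real.log ((g K s) ^ 2)⁻¹) →
      (∀ K, K₀ ≤ K → x₀ ≤ Real.log ((g K K) ^ 2)⁻¹) →
      ∀ {ρbar ηbar : ℝ}, (∀ K j, ∑ b ∈ B K j, rho C (g K) b ≤ ρbar) →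
      (∀ K j, ∀ t ∈ Ioc j K, ∑ e ∈ E K j with PEv.step e = t, eta C e ≤ ηbar) →
      Λ * Real.exp (ηbar - C.κ₁) < 1 →
      ∀ {Λ' : ℝ}, 0 ≤ Λ' → Λ' * Real.exp ε * Real.exp (-C.κ₁) ≤ 1 →
      ∀ (y : ℕ → ℕ → γ → PEv → Finset PEv → ℝ),
      (∀ K, ∀ j ≤ K, ∀ z ∈ Cell K (K - j), ∀ b ∈ B K j,
        ∀ Q ∈ records (dictW (R K) C.n₁) j K (E K j) b, 0 ≤ y K j z b Q) →
      (∀ K, K₀ ≤ K → ∀ j ≤ K, ∀ z ∈ Cell K (K - j), ∀ b ∈ B K j,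
        ∀ Q ∈ records (dictW (R K) C.n₁) j K (E K j) b,
        y K j z b Q ≤ 0 ∨ ∃ G : Gen PEv, Consistent C K (R K) G ∧ G.WF (dictW (R K) C.n₁) ∧ G.rootStep = j ∧
          K < G.reach (dictW (R K) C.n₁) ∧ G.root = b ∧ G.events.erase G.root = Q ∧
          y K j z b Q ≤ Kz ^ (merges G).card * (∏ e ∈ merges G, Crowding.Q (wcnt G) σ e.step ^ p) *
            Λ' ^ partnerAges PEv.step G * (Real.exp (-credits (credit C (g K)) G) *
              Real.exp (lifeCost (dictW (R K) C.n₁) (cost C K (R K)) G))) →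
      ∀ (str : ℕ → κ → Finset (Slot γ PEv)),
      (∀ K t, |t| ≤ l₀ → K₀ ≤ K → Set.InjOn (str K) (Bad' K t)) →
      (∀ K t, |t| ≤ l₀ → K₀ ≤ K → ∀ c ∈ Bad' K t,
        str K c ⊆ liveSlots Cell (dictW (R K) C.n₁) E B K ∧
          ∃ o ∈ oldSlots Cell (dictW (R K) C.n₁) E B jstar K, o ∈ str K c) →
      (∀ K t, |t| ≤ l₀ → K₀ ≤ K → ∀ c ∈ Bad' K t, F K c * Rf K c ≤ famWeight (slotPrice (y K)) (str K c)) →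
      (∀ K t, |t| ≤ l₀ → K₀ ≤ K → ∀ c ∈ Bad' K t, F' K c * Rf' K c ≤ famWeight (slotPrice (y K)) (str K c)) →
      ∃ K₁, K₀ ≤ K₁ ∧ RelWeightBound l₀ T A A' (fun K t => if K₁ ≤ K then badOfClass π T Bad' K t else ∅)
        (Set.indicator {K | K₁ ≤ K} (fun K => Cn * recordsBudget ρbar C.κ₁ V Λ ηbar jstar K)) := by
  have hθz : 0 ≤ zoneRate Kz p σ ε θ := zoneRate_nonneg hKz hp h0 h1 hθ.le
  obtain ⟨x₀, hx₀⟩ := exists_irThreshold_relWeightBoundG C hC hθz ha hA₀ hL hβ hrq Cell hV hΛ hcell E B hE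
    jstar hj hc hfrac hA hA' hCn
  refine ⟨x₀, ?_⟩
  intro R g β' h27 h29 hR hx1 hir ρbar ηbar hρbar hηbar hr Λ' hΛ0 hΛ1 y hy0 hlabZ str hinj hstr hF hF'
  have hΛ0' : 0 ≤ Λ' * Real.exp ε := mul_nonneg hΛ0 (Real.exp_pos ε).le
  have hlabG : ∀ K, K₀ ≤ K → ∀ j ≤ K, ∀ z ∈ Cell K (K - j), ∀ b ∈ B K j,
      ∀ Q ∈ records (dictW (R K) C.n₁) j K (E K j) b,
      y K j z b Q ≤ 0 ∨ ∃ G : Gen PEv, Consistent C K (R K) G ∧ G.WF (dictW (R K) C.n₁) ∧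
        G.rootStep = j ∧ K < G.reach (dictW (R K) C.n₁) ∧ G.root = b ∧ G.events.erase G.root = Q ∧
        y K j z b Q ≤ Real.exp (zoneRate Kz p σ ε θ * ∑ b' ∈ births G, ((b'.fat : ℝ) + 1)) *
          ((Λ' * Real.exp ε) ^ partnerAges PEv.step G * (Real.exp (-credits (credit C (g K)) G) *
            Real.exp (lifeCost (dictW (R K) C.n₁) (cost C K (R K)) G))) := by
    intro K hK j hj z hz b hb Q hQ
    rcases hlabZ K hK j hj z hz b hb Q hQ with h0' | ⟨G, hcG, hW, hrs, hKr, hroot, hQ', hy⟩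
    · exact Or.inl h0'
    · refine Or.inr ⟨G, hcG, hW, hrs, hKr, hroot, hQ', hy.trans ?_⟩
      have key := zone_surcharge_le (dictW (R K) C.n₁) hKz hp h0 h1 hε hθ hΛ0 hcG hW
      have hX : 0 ≤ Real.exp (-credits (credit C (g K)) G) *
          Real.exp (lifeCost (dictW (R K) C.n₁) (cost C K (R K)) G) := by positivity
      calc Kz ^ (merges G).card * (∏ e ∈ merges G, Crowding.Q (wcnt G) σ e.step ^ p) *
            Λ' ^ partnerAges PEv.step G * (Real.exp (-credits (credit C (g K)) G) *
              Real.exp (lifeCost (dictW (R K) C.n₁) (cost C K (R K)) G))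
          ≤ Real.exp (zoneRate Kz p σ ε θ * ∑ b' ∈ births G, ((b'.fat : ℝ) + 1)) *
              (Λ' * Real.exp ε) ^ partnerAges PEv.step G * (Real.exp (-credits (credit C (g K)) G) *
              Real.exp (lifeCost (dictW (R K) C.n₁) (cost C K (R K)) G)) := mul_le_mul_of_nonneg_right key hX
        _ = _ := by ring
  exact hx₀ R g β' h27 h29 hR hx1 hir hρbar hηbar hr hΛ0' (by simpa [mul_assoc] using hΛ1) y hy0 hlabG str
    hinj hstr hF hF'

end EndToEnd

/-! ## §3 Sanity -/

namespace Sanity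

/-- the zone rate at `Kz = 1` has no `log` part: `zoneRate 1 p σ ε θ = θ + 2·crowdA` [folklore] -/
theorem zoneRate_one (p σ ε θ : ℝ) : zoneRate 1 p σ ε θ = θ + 2 * crowdA p σ (min ε θ / 8) := by
  simp [zoneRate]

end Sanity

end

end Summit.QuantumFields.BalabanUV.T4Continuum.PartnerMultiplicityZ
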